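import Summits.BirchSwinnertonDyer.BirchSwinnertonDyer.Theorems.GoldfeldAllTwistsTwoConverseTwinInertSevenPartnerRank
import Summits.BirchSwinnertonDyer.BirchSwinnertonDyer.Theorems.GoldfeldAllTwistsTwoConverseTwinAdditiveTwoAdicPOne
import HarnessLib

set_option linter.dupNamespace false -- namespace `…BirchSwinnertonDyer.BirchSwinnertonDyer…` is the cell's (D-0017 nested layout)
set_option autoImplicit false

/-!
# Cell C7A partner `49a1^{(p)}` at `p ≡ 1 (mod 8)` with split symbol `σ(p) = −1` (= type α), file D1-split: the `2`-isogeny Selmer sets are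
# minimal — `S(p) ⊆ {1, 7}`, `S′(p) ⊆ {1, −7}` — hence `rank 49a1^{(p)}(ℚ) = 0` and `Ш[2] = 0` (FACT-FREE; c301's `ℓ ≡ 5 (8)` law twinned)

Cell `bsd-goldfeld`, seat `bsd-goldfeld-s1p-c3x` (gen 13); planner RULING (ccclx) «OBJECT C7A BY THE χ_Z CHANNEL», tranche T3, file D1-split (memo
`HOME/C7A-CHIZ-CHANNEL.md` §3: the input of the χ_p-α / χ_e-α package valuation `ord₂ L^{alg}(49a1^{(p)}) = 1`, file D2-split). `--supports
stmt-BirchSwinnertonDyer-20044` as a HELPER. Theses-free; theorems only; no definition, no fact binder, no `sorry`. FRONTIER-grade: a twist-density-ZERO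
sub-family; never distance-to-summit.

SETTING = c301's `…TwinInertSevenPartnerSelmer` §4 / `…PartnerRank` §2 (`ℓ ≡ 5 (mod 8)`) with `p ≡ 1 (mod 8)`: models `E_p : y² = x³ + 21p x² + 112p² x
≅ 49a1^{(p)}`, `S(p) = S(21p, 112p²)`, `S′(p) = S(−42p, −7p²)`; split symbol `σ(p) = −1` choice-free as `hσ : ∀ s, s² = −7 → 2(s − 21) ∉ 𝔽_p²`
(= type α for `p ≡ 1 (4)`: `symbolNeg_iff_not_exists_pow_four`). KILLS (kit j317613, 47/47 C7A rows): `S`: negatives at `ℝ`; `p, 7p` at `p` (the symbol,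
`ell_classes_not_mem_selmer_posTwist_of_symbol_neg` — mod-8-free); **`2, 14` and `2p, 14p` at the prime `2`** (D0-(L2): `u = p ≡ 1 (8)` is a `ℤ₂`-square, numeric
quartics `(21; 2, 56)`, `(21; 14, 8)` — at `ℓ ≡ 5 (8)` c301 killed every even class by `not_isSoluble_two_evenClass_of_mod_eight`); `S′`: c301's `7`-adic and
symbol kills VERBATIM (no even classes there).
* §1 the two common-factor `2`-adic kills (`2u, 14u ∈ S(21u, 112u²)`, `8 ∣ u − 1`); §2 `selmer_posTwist_subset_of_symbol_neg_pOne`;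
  §3 `rank_eq_zero_and_sha_two_posTwist_of_symbol_neg_pOne` (+ the two-torsion-model form).
HONEST FRAMING: Selmer counts and a rank-`0`/`Ш[2] = 0` statement for one partner twist; items 19140 / 20044 unchanged; BSD is not proved by any of this.

References: [SilvermanAEC2009] Thm. X.4.2(a), Prop. X.4.9, Example X.4.10; [Serre1973] Ch. II §3.3 Thm 4.
-/

noncomputable section

open scoped Classical

open WeierstrassCurve Literature.NumberTheory.EllipticCurves
open Literature.NumberTheory.EllipticCurves.Zywina2025 (exists_padicInt_of_isSoluble
  isSquare_zmod_of_isSoluble_padic)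

namespace Summit.BirchSwinnertonDyer.BirchSwinnertonDyer.Theorems.GoldfeldGoodTwists

/-! ## §1 The even classes `2u, 14u` of `S(21u, 112u²)` at `u ≡ 1 (mod 8)` -/

section EvenClasses
variable {u : ℤ}

/-- **Class `2u ∈ S(21u, 112u²)` dies at `2`** (`8 ∣ u − 1`): common factor `u ↦ 1` gives the numeric `(21; 2, 56)`. [cite: SilvermanAEC2009, Prop. X.4.9]
[cite: Serre1973, Ch. II §3.3 Thm 4] -/
theorem not_isSoluble_two_class_twoU_odd (h8 : (8 : ℤ) ∣ u - 1) {a d d' : ℤ} (ha : a = 21 * u) (hd : d = 2 * u) (hd' : d' = 56 * u) :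
    ¬ ((twoIsogenyQuartic a d d').map (Int.castRingHom ℚ_[2])).IsSoluble := fun h ↦ by
  have h1 := isSoluble_two_of_common_factor (n := u) (n₀ := 1) (by simpa using h8) (a₀ := 21) (d₀ := 2) (e₀ := 56)
    (by rw [ha]; ring) (by rw [hd]; ring) (by rw [hd']; ring) h
  norm_num at h1
  exact not_isSoluble_two_numeric_two_odd_pOneAlpha h1

/-- **Class `14u ∈ S(21u, 112u²)` dies at `2`** (`8 ∣ u − 1`): common factor `u ↦ 1` gives the numeric `(21; 14, 8)`. [cite: SilvermanAEC2009, Prop. X.4.9]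
[cite: Serre1973, Ch. II §3.3 Thm 4] -/
theorem not_isSoluble_two_class_fourteenU_odd (h8 : (8 : ℤ) ∣ u - 1) {a d d' : ℤ} (ha : a = 21 * u) (hd : d = 14 * u) (hd' : d' = 8 * u) :
    ¬ ((twoIsogenyQuartic a d d').map (Int.castRingHom ℚ_[2])).IsSoluble := fun h ↦ by
  have h1 := isSoluble_two_of_common_factor (n := u) (n₀ := 1) (by simpa using h8) (a₀ := 21) (d₀ := 14) (e₀ := 8)
    (by rw [ha]; ring) (by rw [hd]; ring) (by rw [hd']; ring) h
  norm_num at h1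
  exact not_isSoluble_two_numeric_fourteen_odd_pOneAlpha h1

end EvenClasses

/-! ## §2 `σ(p) = −1` at `p ≡ 1 (mod 8)`: the Selmer sets of `49a1^{(p)}` are minimal -/

section PosTwistPOne

variable {l : ℕ} [Fact l.Prime]

/-- Divisors of a prime, in `ℤ`: `e ∣ ℓ` ⇒ `e ∈ {1, −1, ℓ, −ℓ}`. [folklore] -/
private theorem eq_of_dvd_prime_int_pOne {e : ℤ} (he : e ∣ (l : ℤ)) :
    e = 1 ∨ e = -1 ∨ e = l ∨ e = -(l : ℤ) := by
  have hl : l.Prime := Fact.out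
  have h1 : e.natAbs ∣ l := Int.natAbs_dvd_natAbs.mpr (by simpa using he)
  rcases (Nat.dvd_prime hl).mp h1 with h | h
  · rcases Int.natAbs_eq e with h' | h' <;> rw [h] at h' <;> simp [h']
  · rcases Int.natAbs_eq e with h' | h' <;> rw [h] at h' <;> simp [h']

/-- `(ℓ/7) = 1` for `ℓ ≡ 1 (mod 4)` with `(−7/ℓ) = 1`; hence `ℓ` is a non-zero square mod `7`, and `−ℓ`, `−1` are not.
[folklore] -/
private theorem zmod_seven_l_facts_pOne (hl4 : l % 4 = 1) (hl7 : legendreSym l (-7) = 1) (hl7' : l ≠ 7) :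
    IsSquare ((l : ℤ) : ZMod 7) ∧ ¬ IsSquare ((-(l : ℤ) : ℤ) : ZMod 7) ∧ ¬ IsSquare ((-1 : ℤ) : ZMod 7) := by
  haveI : Fact (Nat.Prime 7) := ⟨by norm_num⟩
  have hl : l.Prime := Fact.out
  have hl2 : l ≠ 2 := by rintro rfl; norm_num at hl4
  have hl07 : ((l : ℤ) : ZMod 7) ≠ 0 := by
    rw [Ne, ZMod.intCast_zmod_eq_zero_iff_dvd]
    intro h
    exact hl7' ((Nat.prime_dvd_prime_iff_eq (by norm_num) hl).mp (by exact_mod_cast h)).symm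
  have h1 : legendreSym l (-1) = 1 := by rw [legendreSym.at_neg_one hl2, ZMod.χ₄_nat_one_mod_four hl4]
  have h7 : legendreSym l 7 = 1 := by
    have hmul : legendreSym l (-7) = legendreSym l (-1) * legendreSym l 7 := by rw [← legendreSym.mul]; norm_num
    rwa [hmul, h1, one_mul] at hl7
  have h7l : legendreSym 7 l = 1 := by
    rw [legendreSym.quadratic_reciprocity_one_mod_four hl4 (by norm_num)]; exact_mod_cast h7
  have hsq : IsSquare ((l : ℤ) : ZMod 7) := (legendreSym.eq_one_iff 7 hl07).mp h7l
  have hm1' : ∀ r : ZMod 7, r * r ≠ -1 := zmod_seven_nonresidues_neg_one_neg_sq.1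
  have hm1 : ¬ IsSquare ((-1 : ℤ) : ZMod 7) := by
    rintro ⟨r, hr⟩; push_cast at hr; exact hm1' r hr.symm
  refine ⟨hsq, ?_, hm1⟩
  rintro ⟨r, hr⟩
  obtain ⟨q, hq⟩ := hsq
  push_cast at hq hr
  have hq0 : q ≠ 0 := by rintro rfl; exact hl07 (by push_cast; simpa using hq)
  refine hm1' (r / q) ?_
  rw [div_mul_div_comm, div_eq_iff (mul_ne_zero hq0 hq0)]
  linear_combination -hr - hq

/-- **`σ(ℓ) = −1` ⇒ `S(ℓ) ⊆ {1, 7}` and `S′(ℓ) ⊆ {1, −7}`** for a prime `ℓ ≡ 1 (mod 8)` with `(−7/ℓ) = 1` (symbol choice-free: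
`2(s − 21) ∉ 𝔽_ℓ²` for every `s` with `s² = −7`). Places used: `∞`, `2` (the four even classes, D0-(L2) numerics), `7` (`S′`), `ℓ` (the split symbol).
[cite: SilvermanAEC2009, Prop. X.4.9 and Example X.4.10] -/
theorem selmer_posTwist_subset_of_symbol_neg_pOne (hl8 : l % 8 = 1) (hl7 : legendreSym l (-7) = 1)
    (hσ : ∀ s : ZMod l, s ^ 2 = -7 → ¬ IsSquare (2 * (s - 21))) :
    twoIsogenySelmerGroup (21 * (l : ℤ)) (112 * (l : ℤ) ^ 2) ⊆ ({1, 7} : Finset ℤ) ∧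
      twoIsogenySelmerGroup (-42 * (l : ℤ)) (-7 * (l : ℤ) ^ 2) ⊆ ({1, -7} : Finset ℤ) := by
  have hl : l.Prime := Fact.out
  have hlp : Prime (l : ℤ) := Nat.prime_iff_prime_int.mp hl
  have hl2 : l ≠ 2 := by rintro rfl; norm_num at hl8
  have hl7' : l ≠ 7 := by rintro rfl; norm_num at hl8
  have hl4 : l % 4 = 1 := by omega
  have hl0 : (l : ℤ) ≠ 0 := by exact_mod_cast hl.ne_zero
  have hlpos : (0 : ℤ) < l := by exact_mod_cast hl.pos
  obtain ⟨s, t, hs, ht⟩ := exists_sq_eq_neg_seven_and_sq_eq_seven hl4 hl7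
  obtain ⟨hSl, hS7l, hS'l, hS'7l⟩ := ell_classes_not_mem_selmer_posTwist_of_symbol_neg hl2 hl7' hs ht (hσ s hs)
  have h8 : (8 : ℤ) ∣ (l : ℤ) - 1 := by
    have : (8 : ℤ) ∣ ((l : ℕ) : ℤ) - 1 := by omega
    exact this
  have h7l : ¬ (7 : ℤ) ∣ (l : ℤ) := fun h =>
    hl7' ((Nat.prime_dvd_prime_iff_eq (by norm_num) hl).mp (by exact_mod_cast h)).symm
  refine ⟨?_, ?_⟩
  · -- S(ℓ) ⊆ {1, 7}
    intro d hd
    have hb : (112 * (l : ℤ) ^ 2 : ℤ) ≠ 0 := by positivity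
    have hd0 := hd
    rw [mem_twoIsogenySelmerGroup_iff hb] at hd
    obtain ⟨hsqf, ⟨d', hdd'⟩, hloc⟩ := hd
    have hd'eq : (112 * (l : ℤ) ^ 2 : ℤ) / d = d' := by rw [hdd', Int.mul_ediv_cancel_left _ hsqf.ne_zero]
    rw [hd'eq] at hloc
    obtain ⟨hreal, hpadic⟩ := hloc
    -- ∞ : d > 0
    have hdpos : 0 < d := by
      rcases lt_or_gt_of_ne hsqf.ne_zero with hneg | hpos
      · exfalso
        refine not_isSoluble_real_twoIsogenyQuartic_of_neg_of_sq_lt hneg ?_ hreal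
        nlinarith [sq_nonneg (l : ℤ), hlpos]
      · exact hpos
    -- d ∣ 14ℓ
    have h0 : d ∣ 112 * (l : ℤ) ^ 2 := ⟨d', hdd'⟩
    have h1 : d ∣ (14 * (l : ℤ)) ^ 4 := h0.trans ⟨343 * (l : ℤ) ^ 2, by ring⟩
    have h14l : d ∣ 14 * (l : ℤ) := (hsqf.dvd_pow_iff_dvd (by norm_num)).mp h1
    by_cases hld : (l : ℤ) ∣ d
    · -- `d = ℓ·e`, `e ∣ 14`: `ℓ, 7ℓ` at `ℓ` (symbol), `2ℓ, 14ℓ` at `2`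
      exfalso
      obtain ⟨e, rfl⟩ := hld
      have he14 : e ∣ 14 := (mul_dvd_mul_iff_left hl0).mp (by simpa [mul_comm] using h14l)
      have hepos : 0 < e := pos_of_mul_pos_right hdpos hlpos.le
      have hele : e ≤ 14 := Int.le_of_dvd (by norm_num) he14
      have hd'e : e * d' = 112 * (l : ℤ) := mul_left_cancel₀ hl0 (by linear_combination (-1 : ℤ) * hdd')
      interval_cases e <;> try omega
      · exact hSl (by simpa using hd0)
      · exact not_isSoluble_two_class_twoU_odd (u := (l : ℤ)) h8 rfl (by ring) (show d' = 56 * (l : ℤ) by linarith) (hpadic 2)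
      · exact hS7l (by simpa [mul_comm] using hd0)
      · exact not_isSoluble_two_class_fourteenU_odd (u := (l : ℤ)) h8 rfl (by ring) (show d' = 8 * (l : ℤ) by linarith) (hpadic 2)
    · -- `d ∣ 14`: `2, 14` at `2`
      have hcop : IsCoprime d (l : ℤ) := ((hlp.irreducible.coprime_iff_not_dvd).mpr hld).symm
      have hd14 : d ∣ 14 := hcop.dvd_of_dvd_mul_right h14l
      have hle : d ≤ 14 := Int.le_of_dvd (by norm_num) hd14
      have hne2 : d ≠ 2 := by
        rintro rfl
        exact not_isSoluble_two_class_two_odd (u := (l : ℤ)) h8 rfl rfl (show d' = 56 * (l : ℤ) ^ 2 by linarith) (hpadic 2)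
      have hne14 : d ≠ 14 := by
        rintro rfl
        exact not_isSoluble_two_class_fourteen_odd (u := (l : ℤ)) h8 rfl rfl (show d' = 8 * (l : ℤ) ^ 2 by linarith) (hpadic 2)
      interval_cases d <;> first | (exfalso; omega) | simp
  · -- S'(ℓ) ⊆ {1, −7}
    intro d hd
    have hb : (-7 * (l : ℤ) ^ 2 : ℤ) ≠ 0 := mul_ne_zero (by norm_num) (pow_ne_zero 2 hl0)
    have hd0 := hd
    rw [mem_twoIsogenySelmerGroup_iff hb] at hd
    obtain ⟨hsqf, ⟨d', hdd'⟩, -⟩ := hd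
    have h2' : d ∣ (7 * (l : ℤ)) ^ 2 := ⟨-7 * d', by linear_combination (-7) * hdd'⟩
    have h7l2 : d ∣ 7 * (l : ℤ) := (hsqf.dvd_pow_iff_dvd (by norm_num)).mp h2'
    obtain ⟨hsql, hnsql, hnsq1⟩ := zmod_seven_l_facts_pOne hl4 hl7 hl7'
    have hp7 : Prime (7 : ℤ) := by norm_num
    by_cases h7d : (7 : ℤ) ∣ d
    · obtain ⟨d₂, rfl⟩ := h7d
      have hd₂l : d₂ ∣ (l : ℤ) := (mul_dvd_mul_iff_left (by norm_num : (7 : ℤ) ≠ 0)).mp h7l2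
      have h7d₂ : ¬ (7 : ℤ) ∣ d₂ := by
        rintro ⟨k, rfl⟩; exact hp7.not_unit (hsqf 7 ⟨k, by ring⟩)
      have hsq := isSquare_neg_zmod_seven_of_seven_mul_mem_selmer' h7l h7d₂ hd0
      rcases eq_of_dvd_prime_int_pOne hd₂l with rfl | rfl | rfl | rfl
      · exact absurd hsq (by simpa using hnsq1)
      · simp
      · exact absurd hsq hnsql
      · exfalso; exact hS'7l (by simpa using hd0)
    · have hcop : IsCoprime d 7 := ((hp7.irreducible.coprime_iff_not_dvd).mpr h7d).symm
      have hdl : d ∣ (l : ℤ) := hcop.dvd_of_dvd_mul_left h7l2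
      have hsq := isSquare_zmod_seven_of_mem_selmer' h7l h7d hd0
      rcases eq_of_dvd_prime_int_pOne hdl with rfl | rfl | rfl | rfl
      · simp
      · exact absurd hsq hnsq1
      · exfalso; exact hS'l hd0
      · exact absurd hsq hnsql

/-! ## §3 `σ(p) = −1` at `p ≡ 1 (mod 8)`: `rank 49a1^{(p)}(ℚ) = 0` and `Ш[2] = 0` -/

/-- **`σ(ℓ) = −1` ⇒ `rank = 0` and `Ш[2] = 0` for the two-torsion model `E_ℓ : y² = x³ + 21ℓx² + 112ℓ²x`**, `ℓ ≡ 1 (mod 8)`.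
[cite: SilvermanAEC2009, Thm. X.4.2(a) and Prop. X.4.9] -/
theorem rank_eq_zero_and_sha_two_twoTorsionModel_posTwist_of_symbol_neg_pOne (hl8 : l % 8 = 1)
    (hl7 : legendreSym l (-7) = 1) (hσ : ∀ s : ZMod l, s ^ 2 = -7 → ¬ IsSquare (2 * (s - 21)))
    [hE : (⟨0, ((21 * (l : ℤ) : ℤ) : ℚ), 0, ((112 * (l : ℤ) ^ 2 : ℤ) : ℚ), 0⟩ : WeierstrassCurve ℚ).IsElliptic] :
    (⟨0, ((21 * (l : ℤ) : ℤ) : ℚ), 0, ((112 * (l : ℤ) ^ 2 : ℤ) : ℚ), 0⟩ : WeierstrassCurve ℚ).mordellWeilRank = 0 ∧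
      ∀ c ∈ (⟨0, ((21 * (l : ℤ) : ℤ) : ℚ), 0, ((112 * (l : ℤ) ^ 2 : ℤ) : ℚ), 0⟩ : WeierstrassCurve ℚ).sha,
        2 • c = 0 → c = 0 := by
  have hl : l.Prime := Fact.out
  have hab := hab_posTwist (M := (l : ℤ)) (by exact_mod_cast hl.ne_zero)
  haveI := isElliptic_halfModel hab
  obtain ⟨hS, hS'⟩ := selmer_posTwist_subset_of_symbol_neg_pOne hl8 hl7 hσ
  refine rank_eq_zero_and_sha_two_of_card_le_two hab ((Finset.card_le_card hS).trans (by simp)) ?_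
  rw [twoIsogenySelmerGroup'_eq, show (-2 * (21 * (l : ℤ))) = -42 * l by ring,
    show ((21 * (l : ℤ)) ^ 2 - 4 * (112 * (l : ℤ) ^ 2)) = -7 * l ^ 2 by ring]
  exact (Finset.card_le_card hS').trans (by simp)

/-- **`σ(ℓ) = −1` ⇒ `rank W(ℚ) = 0` and `Ш(W/ℚ)[2] = 0` for EVERY model `W` of `49a1^{(ℓ)}`** (`ℓ ≡ 1 (mod 8)` prime, `(−7/ℓ) = 1`,
`2(s−21) ∉ 𝔽_ℓ²` for all `s² = −7`, i.e. type α). UNCONDITIONAL. [cite: SilvermanAEC2009, Thm. X.4.2(a), Prop. X.4.9, III.3.1(b)] -/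
theorem rank_eq_zero_and_sha_two_posTwist_of_symbol_neg_pOne (hl8 : l % 8 = 1) (hl7 : legendreSym l (-7) = 1)
    (hσ : ∀ s : ZMod l, s ^ 2 = -7 → ¬ IsSquare (2 * (s - 21))) (W : WeierstrassCurve ℚ) [W.IsElliptic]
    (C : VariableChange ℚ) (hC : C • W = cm7.quadraticTwist ((l : ℤ) : ℚ)) :
    W.mordellWeilRank = 0 ∧ ∀ c ∈ W.sha, 2 • c = 0 → c = 0 := by
  have hl : l.Prime := Fact.out
  haveI := isElliptic_mk_of_ne_zero (F := ℚ) (hab_posTwist (M := (l : ℤ)) (by exact_mod_cast hl.ne_zero))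
  have hE := smul_eq_twoTorsionModel_of_smul_eq_quadraticTwist (l : ℤ) W C hC
  exact rank_eq_zero_and_sha_two_of_smul_eq W _ _ hE
    (rank_eq_zero_and_sha_two_twoTorsionModel_posTwist_of_symbol_neg_pOne hl8 hl7 hσ)

end PosTwistPOne

end Summit.BirchSwinnertonDyer.BirchSwinnertonDyer.Theorems.GoldfeldGoodTwists
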